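import Summits.CriticalPhenomena.PercolationContinuityZ3.Theorems.Transplant.FKThreeApexT3EnvelopeCertQ2B
import HarnessLib

/-!
# The three-apex monoid: (A) for `q ∈ [11/40, 3/10]` — the assembled identity and `envelopeA_of_mem_certQ2_`

Helper file (`--supports stmt-CriticalPhenomena-4575`), FK sub-lane `prim-bschramm-fk-3` (gen 16); builds on p205010 (kernel theorem, internal audit
signed; external expert review pending).  No sorries; standard axioms.  Memo `bschramm/prim-bschramm-fk-3/T3-ENVELOPE.md` §8–§9.

Assembly: `vForm_eq_certQ2_` (from `certQ2_low_eq`, `certQ2_high_eq`) and **`envelopeA_of_mem_certQ2_`** : (A) for `q ∈ [11/40, 3/10]` — every certificate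
term is a product of non-negative factors on the monoid. [folklore]
-/

noncomputable section

namespace Summit.CriticalPhenomena.PercolationContinuityZ3.Theorems

namespace FK

namespace ThreeApex

/-- **Certificate identity** (assembled from the two halves). [folklore] -/
theorem vForm_eq_certQ2_ (q θ θ' : ℝ) (Z : V5) :
    (1 + θ) * (1 + θ') * vForm q θ θ' Z = certQ2_1 q θ θ' Z + certQ2_2 q θ θ' Z + certQ2_3 q θ θ' Z + certQ2_4 q θ θ' Z + certQ2_5 q θ θ' Z + certQ2_6 q θ θ' Z + certQ2_7 q θ θ' Z + certQ2_8 q θ θ' Z + certQ2_9 q θ θ' Z + certQ2_10 q θ θ' Z + certQ2_11 q θ θ' Z + certQ2_12 q θ θ' Z + certQ2_13 q θ θ' Z + certQ2_14 q θ θ' Z := by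
  have h1 := certQ2_low_eq q θ θ' Z
  have h2 := certQ2_high_eq q θ θ' Z
  linarith

set_option maxHeartbeats 20000000 in
/-- **(A) holds for `q ∈ [11/40, 3/10]`**: every certificate term is a product of non-negative factors on the monoid. [folklore] -/
theorem envelopeA_of_mem_certQ2_ {q : ℝ} (hq : ((11 : ℝ) / (40 : ℝ)) ≤ q) (hq1 : q ≤ ((3 : ℝ) / (10 : ℝ))) : EnvelopeA q := by
  intro θ θ' hθ hθ' Z hZ
  have hq0 : 0 < q := by norm_num at hq hq1 ⊢; linarith
  have hq1' : q ≤ 1 := by norm_num at hq hq1 ⊢; linarith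
  obtain ⟨h0, hab, hac, hbc, h1⟩ := hZ.nonneg hq0.le
  obtain ⟨s1, s2, s3⟩ := hZ.s_nonneg hq0.le
  have hB1 : 0 ≤ (40 * q - 11) := by norm_num at hq hq1 ⊢; linarith
  have hB2 : 0 ≤ (12 - 40 * q) := by norm_num at hq hq1 ⊢; linarith
  have hvx : 0 ≤ Z.total - hx Z := by simp only [hx, V5.total]; linarith
  have hvy : 0 ≤ Z.total - hy Z := by simp only [hy, V5.total]; linarith
  have hvz : 0 ≤ Z.total - hz Z := by simp only [hz, V5.total]; linarith
  have hMc : massC q Z = (Z.zac + Z.zbc + q * Z.z0) * (Z.zac + Z.zbc + Z.z1) := by simp only [massC, hx, hy, hz, V5.total]; ring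
  have g0 : 0 ≤ lam Z := hZ.lam_nonneg hq0.le
  have g1 : 0 ≤ massC q Z := by rw [hMc]; positivity
  have g2 : 0 ≤ uForm q 1 1 Z := hZ.uCond hq0 hq1' 1 1 zero_le_one zero_le_one
  have g3 : 0 ≤ uForm q 1 (2 : ℝ) Z := hZ.uCond hq0 hq1' 1 (2 : ℝ) zero_le_one (by norm_num)
  have g4 : 0 ≤ uForm q 1 θ Z := hZ.uCond hq0 hq1' 1 θ zero_le_one hθ
  have g5 : 0 ≤ uForm q 1 ((2 : ℝ) * θ) Z := hZ.uCond hq0 hq1' 1 ((2 : ℝ) * θ) zero_le_one (mul_nonneg (by norm_num) hθ)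
  have g6 : 0 ≤ uForm q 1 ((4 : ℝ) * θ) Z := hZ.uCond hq0 hq1' 1 ((4 : ℝ) * θ) zero_le_one (mul_nonneg (by norm_num) hθ)
  have g7 : 0 ≤ uForm q 1 ((2 : ℝ) * (θ * θ')) Z := hZ.uCond hq0 hq1' 1 ((2 : ℝ) * (θ * θ')) zero_le_one (mul_nonneg (by norm_num) (mul_nonneg hθ hθ'))
  have g8 : 0 ≤ uForm q 1 ((4 : ℝ) * (θ * θ')) Z := hZ.uCond hq0 hq1' 1 ((4 : ℝ) * (θ * θ')) zero_le_one (mul_nonneg (by norm_num) (mul_nonneg hθ hθ'))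
  have g9 : 0 ≤ uForm q 1 θ' Z := hZ.uCond hq0 hq1' 1 θ' zero_le_one hθ'
  have g10 : 0 ≤ uForm q 1 ((2 : ℝ) * θ') Z := hZ.uCond hq0 hq1' 1 ((2 : ℝ) * θ') zero_le_one (mul_nonneg (by norm_num) hθ')
  have g11 : 0 ≤ uForm q θ' 1 Z := hZ.uCond hq0 hq1' θ' 1 hθ' zero_le_one
  have g12 : 0 ≤ uForm q θ' (2 : ℝ) Z := hZ.uCond hq0 hq1' θ' (2 : ℝ) hθ' (by norm_num)
  have g13 : 0 ≤ uForm q θ' θ Z := hZ.uCond hq0 hq1' θ' θ hθ' hθ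
  have g14 : 0 ≤ phiB q 1 1 Z := hZ.phiB_nonneg hq0 hq1' zero_le_one zero_le_one
  have g15 : 0 ≤ phiB q 1 (2 : ℝ) Z := hZ.phiB_nonneg hq0 hq1' zero_le_one (by norm_num)
  have g16 : 0 ≤ phiB q 1 θ Z := hZ.phiB_nonneg hq0 hq1' zero_le_one hθ
  have g17 : 0 ≤ phiB q 1 ((2 : ℝ) * θ) Z := hZ.phiB_nonneg hq0 hq1' zero_le_one (mul_nonneg (by norm_num) hθ)
  have g18 : 0 ≤ phiB q 1 (θ * θ') Z := hZ.phiB_nonneg hq0 hq1' zero_le_one (mul_nonneg hθ hθ')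
  have g19 : 0 ≤ phiB q 1 ((2 : ℝ) * (θ * θ')) Z := hZ.phiB_nonneg hq0 hq1' zero_le_one (mul_nonneg (by norm_num) (mul_nonneg hθ hθ'))
  have g20 : 0 ≤ phiB q 1 ((4 : ℝ) * (θ * θ')) Z := hZ.phiB_nonneg hq0 hq1' zero_le_one (mul_nonneg (by norm_num) (mul_nonneg hθ hθ'))
  have g21 : 0 ≤ phiB q 1 θ' Z := hZ.phiB_nonneg hq0 hq1' zero_le_one hθ'
  have g22 : 0 ≤ phiB q 1 ((2 : ℝ) * θ') Z := hZ.phiB_nonneg hq0 hq1' zero_le_one (mul_nonneg (by norm_num) hθ')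
  have g23 : 0 ≤ phiB q 1 ((4 : ℝ) * θ') Z := hZ.phiB_nonneg hq0 hq1' zero_le_one (mul_nonneg (by norm_num) hθ')
  have g24 : 0 ≤ phiB q θ 1 Z := hZ.phiB_nonneg hq0 hq1' hθ zero_le_one
  have g25 : 0 ≤ phiB q θ (2 : ℝ) Z := hZ.phiB_nonneg hq0 hq1' hθ (by norm_num)
  have g26 : 0 ≤ phiB q θ θ' Z := hZ.phiB_nonneg hq0 hq1' hθ hθ'
  have g27 : 0 ≤ phiB q θ ((2 : ℝ) * θ') Z := hZ.phiB_nonneg hq0 hq1' hθ (mul_nonneg (by norm_num) hθ')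
  have g30 : 0 ≤ (Z.z0 * Z.z0) := mul_nonneg h0 h0
  have g31 : 0 ≤ (Z.z0 * (Z.total - hx Z)) := mul_nonneg h0 hvx
  have g32 : 0 ≤ (Z.z0 * (Z.total - hy Z)) := mul_nonneg h0 hvy
  have g33 : 0 ≤ (Z.z0 * (Z.total - hz Z)) := mul_nonneg h0 hvz
  have g34 : 0 ≤ (Z.zab * Z.z1) := mul_nonneg hab h1
  have g35 : 0 ≤ (Z.zab * Z.z0) := mul_nonneg hab h0
  have g36 : 0 ≤ (Z.zab * (Z.total - hy Z)) := mul_nonneg hab hvy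
  have g37 : 0 ≤ (Z.zab * (Z.total - hz Z)) := mul_nonneg hab hvz
  have g38 : 0 ≤ (Z.zab * Z.zab) := mul_nonneg hab hab
  have g39 : 0 ≤ (Z.zac * Z.z0) := mul_nonneg hac h0
  have g40 : 0 ≤ (Z.zac * (Z.total - hx Z)) := mul_nonneg hac hvx
  have g41 : 0 ≤ (Z.zac * Z.zbc) := mul_nonneg hac hbc
  have g42 : 0 ≤ (Z.zbc * Z.z0) := mul_nonneg hbc h0
  have g43 : 0 ≤ (Z.zbc * (Z.total - hx Z)) := mul_nonneg hbc hvx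
  have hsum : 0 ≤ certQ2_1 q θ θ' Z + certQ2_2 q θ θ' Z + certQ2_3 q θ θ' Z + certQ2_4 q θ θ' Z + certQ2_5 q θ θ' Z + certQ2_6 q θ θ' Z + certQ2_7 q θ θ' Z + certQ2_8 q θ θ' Z + certQ2_9 q θ θ' Z + certQ2_10 q θ θ' Z + certQ2_11 q θ θ' Z + certQ2_12 q θ θ' Z + certQ2_13 q θ θ' Z + certQ2_14 q θ θ' Z := by
    unfold certQ2_1 certQ2_2 certQ2_3 certQ2_4 certQ2_5 certQ2_6 certQ2_7 certQ2_8 certQ2_9 certQ2_10 certQ2_11 certQ2_12 certQ2_13 certQ2_14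
    positivity
  rw [← vForm_eq_certQ2_] at hsum
  exact (mul_nonneg_iff_of_pos_left (by positivity : (0:ℝ) < (1 + θ) * (1 + θ'))).mp hsum

end ThreeApex

end FK

end Summit.CriticalPhenomena.PercolationContinuityZ3.Theorems
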